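import Mathlib.Logic.Equiv.Fin.Basic
import Summits.MatrixMultiplication.MatrixMultiplication.Theses.ReesMunnRealization

/-!
# `FibreLift` — a strict fibre realization lifts to the Rees matrix semigroup

Route `MatrixMultiplication/ReesMunnRealization`, item `stmt-MatrixMultiplication-18278` (support,
the LIFT piece of the typed split `FibreDesignFamily → FibreLift → BlockRestrictionFamily`).

For ANY group `G`, any `n`, any sandwich matrix `P : [n] × [n] → G ∪ {0}` and any strict
realization `(φ, ψ, χ)` of `⟨a, b, e⟩` in the `P`-twisted fibre tensor
`F_P((λ, g), (ι, h)) = g · P[λ, ι] · h ∈ G ∪ {0}`, there is a strict realization `(φ', ψ', χ')` of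
`⟨n·a, b, n·e⟩` in the Rees matrix semigroup `M⁰(G; n, n; P)` (non-zero elements
`(r, g, λ) ∈ [n] × G × [n]`, product `(r, g, λ)(ι, h, γ) = (r, g · P[λ, ι] · h, γ)` or `0`).

Proof ("copy the fibre design into every (row-label, column-label) fibre").  Index
`[n·a] = [n] × [a]` by (row label `ρ`, `i`) and `[n·e] = [n] × [e]` by (column label `γ`, `k`)
via `finProdFinEquiv`, and put
`φ'((ρ,i),j) = (ρ, g_{ij}, λ_{ij})`, `ψ'(j,(γ,k)) = (ι_{jk}, h_{jk}, γ)`,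
`χ'((ρ,i),(γ,k)) = (ρ, χ_{ik}, γ)`.  The Rees product `(ρ, g_{ij} P[λ_{ij}, ι_{jk}] h_{jk}, γ)`
reproduces the fibre condition in its middle coordinate, and the outer coordinates separate the
fibres: the product equals `χ'((ρ',i'),(γ',k'))` iff `ρ = ρ'`, `γ = γ'` and the fibre product
`g_{ij} P[λ_{ij}, ι_{j'k}] h_{j'k}` equals `χ_{i'k'}`, i.e. iff `ρ = ρ'`, `γ = γ'`, `i = i'`, `j = j'`,
`k = k'` by strictness of `(φ, ψ, χ)`.

References: Cohn–Umans 2013, arXiv:1207.6528 (Def. 8, strict realizations); Clifford–Preston Vol. I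
§3 / Steinberg 2016 Ch. 5 (Rees matrix semigroups `M⁰(G; n, n; P)`).
-/

-- single-conjunct summit: the mandated namespace `Summit.MatrixMultiplication.MatrixMultiplication.…`
-- repeats `MatrixMultiplication` (summit = sub-problem), which `linter.dupNamespace` would flag.
set_option linter.dupNamespace false

namespace Summit.MatrixMultiplication.MatrixMultiplication.Theorems

/-- **Fibre lift** (settles `stmt-MatrixMultiplication-18278`, exact route signature
`Summit.MatrixMultiplication.MatrixMultiplication.Theses.ReesMunnRealization.FibreLift`): a strict
realization `(φ, ψ, χ)` of `⟨a, b, e⟩` in the `P`-twisted fibre tensor `F_P` over a group `G`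
yields a strict realization of `⟨n·a, b, n·e⟩` in the Rees matrix semigroup `M⁰(G; n, n; P)`:
index `[n·a] = [n] × [a]` by (row label `ρ`, `i`) and `[n·e] = [n] × [e]` by (column label `γ`,
`k`) via `finProdFinEquiv`, and put `φ'((ρ,i),j) = (ρ, g_{ij}, λ_{ij})`,
`ψ'(j,(γ,k)) = (ι_{jk}, h_{jk}, γ)`, `χ'((ρ,i),(γ,k)) = (ρ, χ_{ik}, γ)`; the Rees product
`(ρ, g P[λ,ι] h, γ)` reproduces the fibre condition in every fibre, and different fibres are
separated by their labels. [folklore] -/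
theorem FibreLift_proof :
    Summit.MatrixMultiplication.MatrixMultiplication.Theses.ReesMunnRealization.FibreLift := by
  unfold Summit.MatrixMultiplication.MatrixMultiplication.Theses.ReesMunnRealization.FibreLift
  intro G _ n a b e P φ ψ χ hfib
  refine ⟨fun x => ((finProdFinEquiv.symm x.1).1, (φ ((finProdFinEquiv.symm x.1).2, x.2)).2,
      (φ ((finProdFinEquiv.symm x.1).2, x.2)).1),
    fun y => ((ψ (y.1, (finProdFinEquiv.symm y.2).2)).1, (ψ (y.1, (finProdFinEquiv.symm y.2).2)).2,
      (finProdFinEquiv.symm y.2).1),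
    fun z => ((finProdFinEquiv.symm z.1).1,
      χ ((finProdFinEquiv.symm z.1).2, (finProdFinEquiv.symm z.2).2), (finProdFinEquiv.symm z.2).1),
    ?_⟩
  rintro ⟨x1, j⟩ ⟨j', y2⟩ ⟨z1, z2⟩
  obtain ⟨⟨ρ, i⟩, rfl⟩ := finProdFinEquiv.surjective x1
  obtain ⟨⟨γ, k⟩, rfl⟩ := finProdFinEquiv.surjective y2
  obtain ⟨⟨ρz, iz⟩, rfl⟩ := finProdFinEquiv.surjective z1
  obtain ⟨⟨γz, kz⟩, rfl⟩ := finProdFinEquiv.surjective z2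
  have h := hfib (i, j) (j', k) (iz, kz)
  simp only [Equiv.symm_apply_apply, EmbeddingLike.apply_eq_iff_eq, Prod.mk.injEq] at h ⊢
  cases hP : P (φ (i, j)).1 (ψ (j', k)).1 with
  | none =>
    rw [hP] at h
    simp only [Option.map_none, reduceCtorEq, false_iff] at h ⊢
    exact fun hh => h ⟨hh.1.2, hh.2.1, hh.2.2.2⟩
  | some p =>
    rw [hP] at h
    simp only [Option.map_some, Option.some.injEq, Prod.mk.injEq] at h ⊢
    constructor
    · rintro ⟨h1, h2, h3⟩
      obtain ⟨h4, h5, h6⟩ := h.mp h2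
      exact ⟨⟨h1.symm, h4⟩, h5, h3.symm, h6⟩
    · rintro ⟨⟨h1, h4⟩, h5, h3, h6⟩
      exact ⟨h1.symm, h.mpr ⟨h4, h5, h6⟩, h3.symm⟩

end Summit.MatrixMultiplication.MatrixMultiplication.Theorems
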